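import Literature.MathematicalPhysics.QuantumManyBody.DyadicCoherentFractionRefinement
import Summits.AtomisticToContinuum.BoseEinsteinCondensation.Theses.BECTangentRigidity

/-!
# Route `BECTangentRigidity`, support item `DyadicMonotone` (stmt-AtomisticToContinuum-13037)

Settles the support item `stmt-AtomisticToContinuum-13037` of route
`route-AtomisticToContinuum-BECTangentRigidity`: **refinement monotonicity of the dyadic coherent
sum** — for every particle number `N`, box side `L`, dyadic level `k` and admissible trial state
`Ψ`,

  `∑_{m : level-k cells} ⟨φ_m, γ_Ψ φ_m⟩ ≤ ∑_{m' : level-(k+1) cells} ⟨φ_{m'}, γ_Ψ φ_{m'}⟩`,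

where `φ_m = ((L/2^k)³)^{-1/2} · 1_{Q_m}` is the flat mode of the half-open dyadic cell
`Q_m = ∏_j [m_j L/2^k, (m_j+1) L/2^k)` and `⟨φ, γ_Ψ φ⟩ = occupation N φ Ψ.ψ` [LSSY2005, §1.2 (1.17)].

The route decl inlines, verbatim, the bodies of `BoseGas.dyCell`, `BoseGas.dyMode` and
`BoseGas.cohSum` of `Literature/MathematicalPhysics/QuantumManyBody/DyadicCoherentFraction.lean`
(`BoseGas.cohSum_eq` is `rfl`), so the item is definitionally
`cohSum N L k Ψ.ψ ≤ cohSum N L (k+1) Ψ.ψ`, which is the Literature theorem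
`BoseGas.cohSum_le_cohSum_succ_trialState`
(`Literature/MathematicalPhysics/QuantumManyBody/DyadicCoherentFractionRefinement.lean`): the eight
half-open children partition the parent cell exactly, the parent flat mode is `8^{-1/2}` times the
sum of the children's flat modes, `|∑_{c ≤ 8} A_c|² ≤ 8 ∑ |A_c|²` (Cauchy–Schwarz) inside the
`Y`-integral of `occupation`, the finite sum commutes with `∫⁻` by measurability of the parametric
cell integrals (`Ψ` is `C¹`, hence measurable), and the children are re-indexed into level `k+1`
(`(m, c) ↦ 2m + c` injective). Degenerate cases (`N = 0`: both sides `0`; `L ≤ 0`: all cells empty)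
are covered by the Literature theorem, which is stated for all `N`, `L`.

No analytic content lives here; this file is the route-facing wrapper.

References: [LSSY2005] Lieb–Seiringer–Solovej–Yngvason, *The Mathematics of the Bose Gas and its
Condensation* (2005), §1.2 (1.17) (occupation / one-particle density matrix).
-/

namespace Summit.AtomisticToContinuum.BoseEinsteinCondensation.Theorems

open Literature.MathematicalPhysics.QuantumManyBody

/-- **Item stmt-AtomisticToContinuum-13037** (`DyadicMonotone` of route `BECTangentRigidity`, exact
route decl): for all `N L k` and every admissible trial state `Ψ : TrialState N L`, the level-`k`
dyadic coherent sum of `Ψ.ψ` is at most the level-`(k+1)` one. After unfolding, the goal is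
definitionally `BoseGas.cohSum N L k Ψ.ψ ≤ BoseGas.cohSum N L (k + 1) Ψ.ψ`
(`BoseGas.cohSum_eq` is `rfl`), closed by `BoseGas.cohSum_le_cohSum_succ_trialState`.
[folklore] -/
theorem becTangentRigidity_dyadicMonotone_proof :
    Summit.AtomisticToContinuum.BoseEinsteinCondensation.Theses.BECTangentRigidity.DyadicMonotone := by
  unfold Theses.BECTangentRigidity.DyadicMonotone
  intro N L k Ψ
  exact BoseGas.cohSum_le_cohSum_succ_trialState L k Ψ

end Summit.AtomisticToContinuum.BoseEinsteinCondensation.Theorems
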